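import Summits.KontsevichZagierPeriods.KontsevichZagierPeriods.Theorems.RootDecompQuadraticDescentRung
import HarnessLib

/-!
# The Dirichlet FAMILY as a two-term coincidence of KZ-rational 3-dimensional representations
realised inside the rules (support for `DescentThreeQ` stmt-KontsevichZagierPeriods-26541 /
`DescentThree` stmt-KontsevichZagierPeriods-24769)

Support file (Theorems-shaped; cell decomp-kz, lens 6 «barrier-complement carving», gen 4), extending the
landed rung `Theorems/RootDecompQuadraticDescentRung.lean` (gen 3, p759419) exactly as the cell critic placed it
(2026-08-30T03:28:30Z, probe `critic_rung_dischargeable_from_QD_hyps`): the Dirichlet identity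
`B(a+b,c)·B(a,b) = B(b,c)·B(a,b+c)` is, one algebraic dimension up, a COINCIDENCE of two KZ-RATIONAL
representations of dimension `3` — the volume-under-the-graph representations `H := graphRep (B₁ × B₂)`,
`H' := graphRep (B₃ × B₄)` of the products of the pinned Euler integrals — realised INSIDE rules 1)–3):
* `dirichletFamily_dim3_coincidence_mem_relations` — `[H] − [H'] ∈ KZ.relations` for ALL rationals `a, b, c`
  and any pinned `Bᵢ` (Fubini `KZ.of_mul_of`, the two Dirichlet charts through `dirichlet_pinned_mem_relations`,
  two Newton–Leibniz moves `KZ.IntegralRep.equivalent_graphRep`);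
* `graphRegion_prod_value` — `value H = B(p,q)·B(p',q')`;
* `dirichletFamily_dim3_specimen` — self-contained: for all rationals `a, b, c > 0` there EXIST KZ-rational
  `H, H'` of dimension `3` with the two (equal) Beta-product values and `[H] − [H'] ∈ KZ.relations`.
For pairwise distinct non-integral Beta classes (e.g. `a = 3/2, b = 4/3, c = 5/4`, Schneider 1941) this family of
PROVED instances of the conclusion layer `Coinc(R,3)` of `DescentThreeQ` / `DescentThree` / `KZ_leRat 3` (at
`R = KZ.relations`) lies outside every proved regime of Conjecture 1 in the tree (dimension `≤ 1`: Baker;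
rational-valued polynomial boxes; the cell span `V`). [Andrews–Askey–Roy 1999, Thm 1.8.1; Kontsevich–Zagier 2001 §1.2]
-/

noncomputable section

namespace Summit.KontsevichZagierPeriods.KontsevichZagierPeriods.Theorems

open Literature.NumberTheory.Transcendental
open Set MeasureTheory

namespace RootDecompQuadraticDescentDirichletFamily

open Literature.NumberTheory.Transcendental.KZ
open RootDecompQuadraticDescentRung


/-- THE DIRICHLET FAMILY ONE ALGEBRAIC DIMENSION UP (gen 4): for all rationals `a, b, c` and any pinned Beta
representations `B₁ = β(a+b,c)`, `B₂ = β(a,b)`, `B₃ = β(b,c)`, `B₄ = β(a,b+c)`, the volume-under-the-graph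
representations of the PRODUCTS, `H := (B₁.prod B₂).graphRep`, `H' := (B₃.prod B₄).graphRep` — KZ-RATIONAL of
dimension `3` (`KZ.IntegralRep.isRational_graphRep`: integrand the last coordinate, domain a `ℚ`-semialgebraic
band over the unit square) — satisfy `[H] − [H'] ∈ KZ.relations`: Fubini (`KZ.of_mul_of`), the two Dirichlet
charts (`dirichlet_pinned_mem_relations`) and two Newton–Leibniz moves (`KZ.IntegralRep.equivalent_graphRep`).
A proved family of instances of the CONCLUSION of `RootDecompQuadraticDescent.DescentThreeQ` /
`RootDecompDimensionDescent.DescentThree` (a coincidence of KZ-rational representations of dimension `≤ 3`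
realised by the moves) and of `KZ_leRat 3`. [Andrews–Askey–Roy 1999, Thm 1.8.1; Kontsevich–Zagier 2001 §1.2] -/
theorem dirichletFamily_dim3_coincidence_mem_relations (a b c : ℚ) (B₁ B₂ B₃ B₄ : KZ.IntegralRep 1)
    (h₁d : B₁.domain = {t | t 0 ∈ Set.Ioo (0:ℝ) 1})
    (h₁i : Set.EqOn B₁.integrand (fun t => (t 0) ^ (((a + b : ℚ) : ℝ) - 1) * (1 - t 0) ^ ((c : ℝ) - 1)) B₁.domain)
    (h₂d : B₂.domain = {t | t 0 ∈ Set.Ioo (0:ℝ) 1})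
    (h₂i : Set.EqOn B₂.integrand (fun t => (t 0) ^ ((a : ℝ) - 1) * (1 - t 0) ^ ((b : ℝ) - 1)) B₂.domain)
    (h₃d : B₃.domain = {t | t 0 ∈ Set.Ioo (0:ℝ) 1})
    (h₃i : Set.EqOn B₃.integrand (fun t => (t 0) ^ ((b : ℝ) - 1) * (1 - t 0) ^ ((c : ℝ) - 1)) B₃.domain)
    (h₄d : B₄.domain = {t | t 0 ∈ Set.Ioo (0:ℝ) 1})
    (h₄i : Set.EqOn B₄.integrand (fun t => (t 0) ^ ((a : ℝ) - 1) * (1 - t 0) ^ (((b + c : ℚ) : ℝ) - 1)) B₄.domain) :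
    KZ.of ((B₁.prod B₂).graphRep Literature.ModelTheory.ExponentialFields.tarski_seidenberg_real_holds) -
        KZ.of ((B₃.prod B₄).graphRep Literature.ModelTheory.ExponentialFields.tarski_seidenberg_real_holds) ∈ KZ.relations := by
  have h := dirichlet_pinned_mem_relations a b c B₁ B₂ B₃ B₄ h₁d h₁i h₂d h₂i h₃d h₃i h₄d h₄i
  rw [of_mul_of, of_mul_of] at h
  have e12 : of ((B₁.prod B₂).graphRep Literature.ModelTheory.ExponentialFields.tarski_seidenberg_real_holds) -
      of (B₁.prod B₂) ∈ relations := ((B₁.prod B₂).equivalent_graphRep _).symm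
  have e34 : of ((B₃.prod B₄).graphRep Literature.ModelTheory.ExponentialFields.tarski_seidenberg_real_holds) -
      of (B₃.prod B₄) ∈ relations := ((B₃.prod B₄).equivalent_graphRep _).symm
  have key := relations.add_mem (relations.sub_mem e12 e34) h
  convert key using 1
  abel

/-- The 3-dimensional rational region over a product of pinned Beta representations has value the
product of the two Beta values (`KZ.IntegralRep.value_prod`, soundness `KZ.Equivalent.value_eq_holds`). -/
theorem graphRegion_prod_value (p q p' q' : ℚ) (hp : 0 < p) (hq : 0 < q) (hp' : 0 < p') (hq' : 0 < q')
    (B B' : KZ.IntegralRep 1)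
    (hd : B.domain = {t | t 0 ∈ Set.Ioo (0:ℝ) 1})
    (hi : Set.EqOn B.integrand (fun t => (t 0) ^ ((p : ℝ) - 1) * (1 - t 0) ^ ((q : ℝ) - 1)) B.domain)
    (hd' : B'.domain = {t | t 0 ∈ Set.Ioo (0:ℝ) 1})
    (hi' : Set.EqOn B'.integrand (fun t => (t 0) ^ ((p' : ℝ) - 1) * (1 - t 0) ^ ((q' : ℝ) - 1)) B'.domain) :
    ((B.prod B').graphRep Literature.ModelTheory.ExponentialFields.tarski_seidenberg_real_holds).value =
      (Real.Gamma p * Real.Gamma q / Real.Gamma (p + q)) *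
        (Real.Gamma p' * Real.Gamma q' / Real.Gamma (p' + q')) := by
  rw [← (KZ.Equivalent.value_eq_holds ((B.prod B').equivalent_graphRep Literature.ModelTheory.ExponentialFields.tarski_seidenberg_real_holds)),
    KZ.IntegralRep.value_prod, pinned_value p q hp hq B hd hi, pinned_value p' q' hp' hq' B' hd' hi']

/-- THE FAMILY, SELF-CONTAINED (gen 4): for all rationals `a, b, c > 0` there are KZ-RATIONAL representations
`H, H'` of dimension `3` with values `B(a+b,c)·B(a,b)` and `B(b,c)·B(a,b+c)` (equal, by Dirichlet) and
`[H] − [H'] ∈ KZ.relations` — a two-term coincidence of 3-dimensional KZ-rational volumes realised INSIDE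
rules 1)–3); for pairwise distinct non-integral Beta classes (e.g. `a = 3/2, b = 4/3, c = 5/4`) it lies
outside every proved regime of Conjecture 1 (dimension `≤ 1`: Baker; rational-valued polynomial boxes). -/
theorem dirichletFamily_dim3_specimen (a b c : ℚ) (ha : 0 < a) (hb : 0 < b) (hc : 0 < c) :
    ∃ H H' : KZ.IntegralRep (1 + 1 + 1),
      H.IsRational ∧ H'.IsRational ∧
      H.value = (Real.Gamma ↑(a + b) * Real.Gamma c / Real.Gamma (↑(a + b) + c)) *
        (Real.Gamma a * Real.Gamma b / Real.Gamma (a + b)) ∧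
      H'.value = (Real.Gamma b * Real.Gamma c / Real.Gamma (b + c)) *
        (Real.Gamma a * Real.Gamma ↑(b + c) / Real.Gamma (a + ↑(b + c))) ∧
      H.value = H'.value ∧
      KZ.of H - KZ.of H' ∈ KZ.relations := by
  obtain ⟨B₁, h₁d, h₁i⟩ := KZ.exists_betaRep' (a + b) c (add_pos ha hb) hc
  obtain ⟨B₂, h₂d, h₂i⟩ := KZ.exists_betaRep' a b ha hb
  obtain ⟨B₃, h₃d, h₃i⟩ := KZ.exists_betaRep' b c hb hc
  obtain ⟨B₄, h₄d, h₄i⟩ := KZ.exists_betaRep' a (b + c) ha (add_pos hb hc)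
  have hrel := dirichletFamily_dim3_coincidence_mem_relations a b c B₁ B₂ B₃ B₄ h₁d (h₁i ▸ fun _ _ => rfl)
      h₂d (h₂i ▸ fun _ _ => rfl) h₃d (h₃i ▸ fun _ _ => rfl) h₄d (h₄i ▸ fun _ _ => rfl)
  have hv : ((B₁.prod B₂).graphRep Literature.ModelTheory.ExponentialFields.tarski_seidenberg_real_holds).value =
      ((B₃.prod B₄).graphRep Literature.ModelTheory.ExponentialFields.tarski_seidenberg_real_holds).value := by
    have h0 := (AddMonoidHom.mem_ker).mp (KZ.relations_le_ker_eval_holds hrel)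
    simp only [map_sub, KZ.eval_of] at h0
    exact sub_eq_zero.mp h0
  refine ⟨(B₁.prod B₂).graphRep Literature.ModelTheory.ExponentialFields.tarski_seidenberg_real_holds, (B₃.prod B₄).graphRep Literature.ModelTheory.ExponentialFields.tarski_seidenberg_real_holds,
    KZ.IntegralRep.isRational_graphRep _ _, KZ.IntegralRep.isRational_graphRep _ _, ?_, ?_, hv, hrel⟩
  · exact graphRegion_prod_value (a + b) c a b (add_pos ha hb) hc ha hb B₁ B₂ h₁d (h₁i ▸ fun _ _ => rfl)
      h₂d (h₂i ▸ fun _ _ => rfl)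
  · exact graphRegion_prod_value b c a (b + c) hb hc ha (add_pos hb hc) B₃ B₄ h₃d (h₃i ▸ fun _ _ => rfl)
      h₄d (h₄i ▸ fun _ _ => rfl)

end RootDecompQuadraticDescentDirichletFamily

end Summit.KontsevichZagierPeriods.KontsevichZagierPeriods.Theorems
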